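import Literature.NumberTheory.Automorphic.AutomorphicGLn
import Literature.NumberTheory.Automorphic.GLnPlacesSplitting
import Literature.NumberTheory.Automorphic.FiniteMultiplicityCriterion
import HarnessLib

/-!
# Cuspidal constituents of `GL_n` with equivalent slices away from `S` coincide, given strong
# multiplicity one
(Gelbart, *Automorphic forms on adele groups* (1975), §10, p. 152 and Thm. 10.10, p. 158, with
Thm. 5.7; Jacquet–Langlands, LNM 114 (1970), §16, pp. 496–503; Piatetski-Shapiro, *Multiplicity
one theorems*, Corvallis (1979))

Topic `NumberTheory/Automorphic`; theorems only (no definition, no named fact, no instance). Part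
of the inline (D-0026) decomposition of the named fact
`Literature.NumberTheory.Automorphic.multiplicity_one_quaternionUnits K D` (`JacquetLanglandsParts`,
Gelbart Thm. 10.10), types route (`QuaternionUnitsMultiplicityOneOfTypeComparison`,
`HilbertRepSliceDecompositionMultiplicityFree`). The abstract multiplicity-freeness theorem
`ContRepresentation.submodule_eq_of_sliceDecomposition` asks, of the orthogonal decomposition of
`L²_cusp(GL_n)` into cuspidal constituents `π` and of the slices `{x ∈ π : E x = x}` cut out by an
operator `E` at the places of `S` (a type projection), two things: the slices are irreducible for
the complementary group `G^S`, and **distinct constituents have inequivalent slices** (`hsep`).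
This file proves the second from **strong multiplicity one for `GL_n` in local-component form**
(the named fact `strong_multiplicity_one_gl_of_hasLocalComponentAt`, Jacquet–Shalika /
Piatetski-Shapiro; Gelbart Thm. 5.7 for `n = 2`), taken as a hypothesis:

* `hasLocalComponentAt_of_sliceIntertwiner` — **local components pass along slice intertwiners**:
  let `E` be an idempotent commuting with the commutant of the regular representation and with
  `R(ι_v GL_n(K_v))`; let `W` be an irreducible closed invariant subspace of `L²` with non-zero
  slice `σ = {x ∈ W : E x = x}`, `W'` another closed invariant subspace with slice `σ'`, and
  `U : σ → σ'` an injective linear map commuting with `R(ι_v g)`. If `W` has local component `ρ` at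
  `v` (a non-zero `GL_n(K_v)`-map `f : ρ → W` along `ι_v`) then so has `W'`: some translate
  `R(c) f`, `c` trivial at `v`, is not killed by `E` (otherwise `E` kills the closed invariant
  subspace generated by `f(ρ)`, which is `W`), and `U ∘ E ∘ R(c) ∘ f : ρ → W'` is a non-zero
  `GL_n(K_v)`-map (`c` commutes with `ι_v`, `GLn.toAdelic_mul_awayFrom`).
* `CuspidalAutomorphicRepGL.eq_of_sliceEquiv` — for cuspidal `P, P'`, a finite set `S` of finite
  places, `E` commuting with `R(ι_v GL_n(K_v))` for `v ∉ S`, non-zero slices and a linear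
  bijection `σ ≃ σ'` commuting with the `R(ι_v g)`, `v ∉ S`: **`P = P'`**, by strong multiplicity
  one (local components at all `v ∉ S` agree, by the previous theorem in both directions).
* `CuspidalAutomorphicRepGL.eq_of_sliceEquiv_trivialAt` — the same with the complementary group
  `G^S = GLn.trivialAt n K S` (`GLnPlacesSplitting`) and an isometric surjection commuting with
  `R(G^S)`: exactly the hypothesis `hsep` of `submodule_eq_of_sliceDecomposition` for
  `τ = R`, `ι = G^S ↪ GL_n(𝔸_K)`, `W = P`, `W' = P'`.

## References

* S. Gelbart, *Automorphic forms on adele groups*, Ann. of Math. Studies 83 (1975), Thm. 5.7,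
  §10 p. 152, Thm. 10.10 (p. 158) [Gelbart1975].
* H. Jacquet, R. P. Langlands, *Automorphic forms on GL(2)*, LNM 114 (1970), §16, pp. 496–503
  [JacquetLanglands1970].
* A. Borel, W. Casselman (eds.), *Automorphic forms, representations and L-functions*, Proc.
  Sympos. Pure Math. 33 (Corvallis 1979): I. Piatetski-Shapiro, *Multiplicity one theorems*
  [Corvallis1979].
-/

noncomputable section

open scoped InnerProductSpace
open NumberField IsDedekindDomain MeasureTheory ContRepresentation

namespace Literature.NumberTheory.Automorphic

section SliceLocalComponent

variable {n : ℕ} {K : Type} [Field K] [NumberField K]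
  {μ : Measure (AdelicGroupData.gl n K).automorphicQuotient}
  [(AdelicGroupData.gl n K).IsAutomorphicMeasure μ]

/-- **Local components pass along slice intertwiners.** Let `E` be an idempotent on
`L²(GL_n(K) A_G ∖ GL_n(𝔸_K))` commuting with the commutant of the regular representation and with
`R(ι_v g)`, `g ∈ GL_n(K_v)`; `W` an irreducible closed invariant subspace with non-zero slice
`σ = {x ∈ W : E x = x}`; `W'` a closed invariant subspace with slice `σ'`; `U : σ → σ'` an
injective linear map commuting with the `R(ι_v g)`. If `W` has local component `ρ` at `v` then so
has `W'`. [cite: Gelbart1975, §10 p. 152; JacquetLanglands1970, §16, pp. 496–503] -/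
theorem hasLocalComponentAt_of_sliceIntertwiner (v : HeightOneSpectrum (𝓞 K))
    (E : ((AdelicGroupData.gl n K).L2 μ) →L[ℂ] ((AdelicGroupData.gl n K).L2 μ)) (hEidem : ∀ y, E (E y) = E y)
    (hET : ∀ T : ((AdelicGroupData.gl n K).L2 μ) →L[ℂ] ((AdelicGroupData.gl n K).L2 μ), (∀ γ, T ∘L ((AdelicGroupData.gl n K).rightRegular μ) γ = ((AdelicGroupData.gl n K).rightRegular μ) γ ∘L T) → T ∘L E = E ∘L T)
    (hEv : ∀ g : GL (Fin n) (v.adicCompletion K),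
      E ∘L ((AdelicGroupData.gl n K).rightRegular μ) (GLn.toAdelic n K v g) = ((AdelicGroupData.gl n K).rightRegular μ) (GLn.toAdelic n K v g) ∘L E)
    (W W' : ClosedSubrep ((AdelicGroupData.gl n K).rightRegular μ)) (hW : W.toContRep.IsTopIrreducible)
    (σ σ' : Submodule ℂ ((AdelicGroupData.gl n K).L2 μ)) (hσ : ∀ x, x ∈ σ ↔ x ∈ W ∧ E x = x)
    (hσ' : ∀ x, x ∈ σ' ↔ x ∈ W' ∧ E x = x) (hσ0 : σ ≠ ⊥)
    (U : σ →ₗ[ℂ] σ') (hUinj : Function.Injective U)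
    (hU : ∀ (g : GL (Fin n) (v.adicCompletion K)) (x : σ)
      (hx : ((AdelicGroupData.gl n K).rightRegular μ) (GLn.toAdelic n K v g) (x : ((AdelicGroupData.gl n K).L2 μ)) ∈ σ),
      (U ⟨((AdelicGroupData.gl n K).rightRegular μ) (GLn.toAdelic n K v g) x, hx⟩ : ((AdelicGroupData.gl n K).L2 μ)) = ((AdelicGroupData.gl n K).rightRegular μ) (GLn.toAdelic n K v g) (U x))
    {V : Type*} [AddCommGroup V] [Module ℂ V]
    (ρ : Representation ℂ (GL (Fin n) (v.adicCompletion K)) V)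
    (h : HasLocalComponentAt W v ρ) : HasLocalComponentAt W' v ρ := by
  have hRu : IsUnitary ((AdelicGroupData.gl n K).rightRegular μ) := (AdelicGroupData.gl n K).isUnitary_rightRegular μ
  obtain ⟨f, hf0, hf⟩ := h
  have hf' : ∀ (g : GL (Fin n) (v.adicCompletion K)) (x : V),
      ((f (ρ g x) : W.toSubmodule) : ((AdelicGroupData.gl n K).L2 μ)) = ((AdelicGroupData.gl n K).rightRegular μ) (GLn.toAdelic n K v g) (f x : ((AdelicGroupData.gl n K).L2 μ)) := by
    intro g x
    rw [hf g x, ClosedSubrep.coe_toContRep_apply, GLn.toAdelic_apply]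
  -- `E` preserves `W` and `W'`
  have hEW : ∀ (X : ClosedSubrep ((AdelicGroupData.gl n K).rightRegular μ)), ∀ y ∈ X, E y ∈ X := fun X y hy =>
    ClosedSubrep.apply_mem_of_forall_comp_eq hRu hET X hy
  -- some translate `R γ (f x)` is not killed by `E`
  obtain ⟨γ₀, x₀, hγ₀⟩ : ∃ (γ : (AdelicGroupData.gl n K).Adelic) (x : V), E (((AdelicGroupData.gl n K).rightRegular μ) γ (f x : ((AdelicGroupData.gl n K).L2 μ))) ≠ 0 := by
    by_contra hall
    push Not at hall
    -- the closed span `N` of the orbit of `f(V)` is a closed invariant subspace of `W`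
    set S₀ : Set ((AdelicGroupData.gl n K).L2 μ) := {z | ∃ (γ : (AdelicGroupData.gl n K).Adelic) (x : V), z = ((AdelicGroupData.gl n K).rightRegular μ) γ (f x : ((AdelicGroupData.gl n K).L2 μ))}
      with hS₀
    set N : Submodule ℂ ((AdelicGroupData.gl n K).L2 μ) := (Submodule.span ℂ S₀).topologicalClosure with hN
    have hS₀inv : ∀ γ₁, ∀ z ∈ S₀, ((AdelicGroupData.gl n K).rightRegular μ) γ₁ z ∈ S₀ := by
      rintro γ₁ _ ⟨γ, x, rfl⟩
      exact ⟨γ₁ * γ, x, by rw [map_mul]; rfl⟩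
    have hspan_inv : ∀ γ₁, ∀ z ∈ Submodule.span ℂ S₀, ((AdelicGroupData.gl n K).rightRegular μ) γ₁ z ∈ Submodule.span ℂ S₀ := by
      intro γ₁ z hz
      have hle : (Submodule.span ℂ S₀).map ((((AdelicGroupData.gl n K).rightRegular μ) γ₁ : ((AdelicGroupData.gl n K).L2 μ) →L[ℂ] ((AdelicGroupData.gl n K).L2 μ)) : ((AdelicGroupData.gl n K).L2 μ) →ₗ[ℂ] ((AdelicGroupData.gl n K).L2 μ)) ≤
          Submodule.span ℂ S₀ := by
        rw [Submodule.map_span]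
        refine Submodule.span_mono ?_
        rintro _ ⟨y, hy, rfl⟩
        exact hS₀inv γ₁ y hy
      exact hle ⟨z, hz, rfl⟩
    have hN_inv : ∀ γ₁, ∀ z ∈ N, ((AdelicGroupData.gl n K).rightRegular μ) γ₁ z ∈ N := by
      intro γ₁ z hz
      have hmaps : Set.MapsTo (((AdelicGroupData.gl n K).rightRegular μ) γ₁) (Submodule.span ℂ S₀ : Set ((AdelicGroupData.gl n K).L2 μ))
          (Submodule.span ℂ S₀ : Set ((AdelicGroupData.gl n K).L2 μ)) := fun y hy => hspan_inv γ₁ y hy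
      have hcl := hmaps.closure (((AdelicGroupData.gl n K).rightRegular μ) γ₁).continuous
      rw [← Submodule.topologicalClosure_coe] at hcl
      exact hcl hz
    let Nc : ClosedSubrep ((AdelicGroupData.gl n K).rightRegular μ) :=
      { toSubmodule := N
        apply_mem_toSubmodule := fun γ z hz => hN_inv γ z hz
        isClosed' := Submodule.isClosed_topologicalClosure _ }
    have hNW : Nc ≤ W := by
      intro z hz
      refine (Submodule.span ℂ S₀).topologicalClosure_minimal ?_ W.isClosed hz
      rw [Submodule.span_le]
      rintro _ ⟨γ, x, rfl⟩
      exact W.apply_mem γ (f x).2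
    -- `N ≠ 0` since `f ≠ 0`
    obtain ⟨x₁, hx₁⟩ : ∃ x, f x ≠ 0 := by
      by_contra h0
      push Not at h0
      exact hf0 (LinearMap.ext h0)
    have hx₁N : ((f x₁ : W.toSubmodule) : ((AdelicGroupData.gl n K).L2 μ)) ∈ N :=
      Submodule.le_topologicalClosure _ (Submodule.subset_span ⟨1, x₁, by
        rw [map_one]; rfl⟩)
    have hNnt : Nontrivial Nc.toSubmodule := by
      refine ⟨⟨⟨_, hx₁N⟩, 0, fun h0 => hx₁ ?_⟩⟩
      have h1 : ((f x₁ : W.toSubmodule) : ((AdelicGroupData.gl n K).L2 μ)) = 0 := congrArg Subtype.val h0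
      rwa [Submodule.coe_eq_zero] at h1
    have hNeq : Nc = W := ClosedSubrep.eq_of_le_of_isTopIrreducible hW hNnt hNW
    -- `E` kills `N = W`
    have hES₀ : ∀ z ∈ S₀, E z = 0 := by
      rintro _ ⟨γ, x, rfl⟩
      exact hall γ x
    have hEspan : ∀ z ∈ Submodule.span ℂ S₀, E z = 0 := by
      intro z hz
      induction hz using Submodule.span_induction with
      | mem y hy => exact hES₀ y hy
      | zero => rw [map_zero]
      | add y z _ _ hy hz => rw [map_add, hy, hz, add_zero]
      | smul a y _ hy => rw [map_smul, hy, smul_zero]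
    have hEN : ∀ z ∈ N, E z = 0 := by
      intro z hz
      have hsub : closure (Submodule.span ℂ S₀ : Set ((AdelicGroupData.gl n K).L2 μ)) ⊆ {z | E z = 0} :=
        closure_minimal (fun y hy => hEspan y hy) (isClosed_eq E.continuous continuous_const)
      have hz' : z ∈ closure (Submodule.span ℂ S₀ : Set ((AdelicGroupData.gl n K).L2 μ)) := by
        rw [← Submodule.topologicalClosure_coe]
        exact hz
      exact hsub hz'
    apply hσ0
    rw [eq_bot_iff]
    intro x hx
    obtain ⟨hxW, hEx⟩ := (hσ x).1 hx
    have hxN : x ∈ Nc := by rw [hNeq]; exact hxW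
    rw [Submodule.mem_bot, ← hEx]
    exact hEN x hxN
  -- move the `v`-component of `γ₀` into `ρ`: `γ₀ = s(γ₀) ι_v(γ₀ᵥ)`
  set c : (AdelicGroupData.gl n K).Adelic := GLn.awayFrom n K v γ₀ with hc
  set x₁ : V := ρ (GLn.toLocalAt n K v γ₀) x₀ with hx₁
  have hc₁ : E (((AdelicGroupData.gl n K).rightRegular μ) c (f x₁ : ((AdelicGroupData.gl n K).L2 μ))) ≠ 0 := by
    have h1 : ((AdelicGroupData.gl n K).rightRegular μ) c (((AdelicGroupData.gl n K).rightRegular μ) (GLn.toAdelic n K v (GLn.toLocalAt n K v γ₀)) (f x₀ : ((AdelicGroupData.gl n K).L2 μ))) =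
        ((AdelicGroupData.gl n K).rightRegular μ) γ₀ (f x₀ : ((AdelicGroupData.gl n K).L2 μ)) := by
      rw [← ContinuousLinearMap.comp_apply (((AdelicGroupData.gl n K).rightRegular μ) c), ← ContinuousLinearMap.mul_def, ← map_mul, hc,
        GLn.awayFrom_mul_toAdelic]
    rw [hx₁, hf', h1]
    exact hγ₀
  have hcomm : ∀ g : GL (Fin n) (v.adicCompletion K),
      ((AdelicGroupData.gl n K).rightRegular μ) c ∘L ((AdelicGroupData.gl n K).rightRegular μ) (GLn.toAdelic n K v g) = ((AdelicGroupData.gl n K).rightRegular μ) (GLn.toAdelic n K v g) ∘L ((AdelicGroupData.gl n K).rightRegular μ) c := by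
    intro g
    rw [← ContinuousLinearMap.mul_def, ← map_mul, ← ContinuousLinearMap.mul_def, ← map_mul, hc,
      GLn.toAdelic_mul_awayFrom]
  -- the new intertwiner `f' = U ∘ E ∘ R(c) ∘ f : V → W'`
  have hmemσ : ∀ x : V, E (((AdelicGroupData.gl n K).rightRegular μ) c (f x : ((AdelicGroupData.gl n K).L2 μ))) ∈ σ := fun x =>
    (hσ _).2 ⟨hEW W _ (W.apply_mem c (f x).2), hEidem _⟩
  let f₁ : V →ₗ[ℂ] σ :=
    { toFun := fun x => ⟨E (((AdelicGroupData.gl n K).rightRegular μ) c (f x : ((AdelicGroupData.gl n K).L2 μ))), hmemσ x⟩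
      map_add' := fun x y => by
        apply Subtype.ext
        change E (((AdelicGroupData.gl n K).rightRegular μ) c ((f (x + y) : W.toSubmodule) : ((AdelicGroupData.gl n K).L2 μ))) =
          E (((AdelicGroupData.gl n K).rightRegular μ) c (f x : ((AdelicGroupData.gl n K).L2 μ))) + E (((AdelicGroupData.gl n K).rightRegular μ) c (f y : ((AdelicGroupData.gl n K).L2 μ)))
        rw [map_add, Submodule.coe_add, map_add, map_add]
      map_smul' := fun a x => by
        apply Subtype.ext
        change E (((AdelicGroupData.gl n K).rightRegular μ) c ((f (a • x) : W.toSubmodule) : ((AdelicGroupData.gl n K).L2 μ))) = a • E (((AdelicGroupData.gl n K).rightRegular μ) c (f x : ((AdelicGroupData.gl n K).L2 μ)))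
        rw [map_smul, Submodule.coe_smul, map_smul, map_smul] }
  have hf₁ : ∀ x, (f₁ x : ((AdelicGroupData.gl n K).L2 μ)) = E (((AdelicGroupData.gl n K).rightRegular μ) c (f x : ((AdelicGroupData.gl n K).L2 μ))) := fun x => rfl
  have hmemW' : ∀ x : V, ((U (f₁ x) : σ') : ((AdelicGroupData.gl n K).L2 μ)) ∈ W' := fun x => ((hσ' _).1 (U (f₁ x)).2).1
  let f' : V →ₗ[ℂ] W'.toSubmodule :=
    { toFun := fun x => ⟨((U (f₁ x) : σ') : ((AdelicGroupData.gl n K).L2 μ)), hmemW' x⟩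
      map_add' := fun x y => by
        apply Subtype.ext
        change ((U (f₁ (x + y)) : σ') : ((AdelicGroupData.gl n K).L2 μ)) = ((U (f₁ x) : σ') : ((AdelicGroupData.gl n K).L2 μ)) + ((U (f₁ y) : σ') : ((AdelicGroupData.gl n K).L2 μ))
        rw [map_add, map_add, Submodule.coe_add]
      map_smul' := fun a x => by
        apply Subtype.ext
        change ((U (f₁ (a • x)) : σ') : ((AdelicGroupData.gl n K).L2 μ)) = a • ((U (f₁ x) : σ') : ((AdelicGroupData.gl n K).L2 μ))
        rw [map_smul, map_smul, Submodule.coe_smul] }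
  have hf'apply : ∀ x, ((f' x : W'.toSubmodule) : ((AdelicGroupData.gl n K).L2 μ)) = ((U (f₁ x) : σ') : ((AdelicGroupData.gl n K).L2 μ)) := fun x => rfl
  refine ⟨f', fun h0 => hc₁ ?_, fun g x => ?_⟩
  · -- `f' ≠ 0`
    have h1 : f' x₁ = 0 := by rw [h0, LinearMap.zero_apply]
    have h2 : U (f₁ x₁) = 0 := by
      apply Subtype.ext
      have := congrArg Subtype.val h1
      exact this
    have h3 : f₁ x₁ = 0 := hUinj (by rw [h2, map_zero])
    have := congrArg Subtype.val h3
    rwa [hf₁] at this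
  · -- intertwining
    apply Subtype.ext
    rw [ClosedSubrep.coe_toContRep_apply, hf'apply, hf'apply, ← GLn.toAdelic_apply]
    have hmem : ((AdelicGroupData.gl n K).rightRegular μ) (GLn.toAdelic n K v g) ((f₁ x : σ) : ((AdelicGroupData.gl n K).L2 μ)) ∈ σ := by
      obtain ⟨hW₁, hE₁⟩ := (hσ _).1 (f₁ x).2
      refine (hσ _).2 ⟨W.apply_mem _ hW₁, ?_⟩
      have h := DFunLike.congr_fun (hEv g) ((f₁ x : σ) : ((AdelicGroupData.gl n K).L2 μ))
      simp only [ContinuousLinearMap.coe_comp, Function.comp_apply] at h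
      rw [h, hE₁]
    rw [← hU g (f₁ x) hmem]
    congr 2
    apply Subtype.ext
    change E (((AdelicGroupData.gl n K).rightRegular μ) c ((f (ρ g x) : W.toSubmodule) : ((AdelicGroupData.gl n K).L2 μ))) = ((AdelicGroupData.gl n K).rightRegular μ) (GLn.toAdelic n K v g) (E (((AdelicGroupData.gl n K).rightRegular μ) c (f x : ((AdelicGroupData.gl n K).L2 μ))))
    have h1 := DFunLike.congr_fun (hcomm g) (f x : ((AdelicGroupData.gl n K).L2 μ))
    have h2 := DFunLike.congr_fun (hEv g) (((AdelicGroupData.gl n K).rightRegular μ) c (f x : ((AdelicGroupData.gl n K).L2 μ)))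
    simp only [ContinuousLinearMap.coe_comp, Function.comp_apply] at h1 h2
    rw [hf', h1, h2]

/-- **Cuspidal constituents with equivalent slices away from `S` coincide, given strong
multiplicity one.** Let `P, P'` be cuspidal automorphic representations of `GL_n(𝔸_K)`, `S` a
finite set of finite places, `E` an idempotent commuting with the commutant of the regular
representation and with `R(ι_v g)` for `v ∉ S` (a type projection at `S`), with non-zero slice
`σ = {x ∈ P : E x = x}` of `P` and slice `σ'` of `P'`, and `U : σ → σ'` a linear bijection
commuting with the `R(ι_v g)`, `v ∉ S`. Then `P` and `P'` have the same local components at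
every `v ∉ S` (`hasLocalComponentAt_of_sliceIntertwiner` in both directions), hence `P = P'` by
strong multiplicity one in local-component form (`strong_multiplicity_one_gl_of_hasLocalComponentAt`,
a hypothesis here). [cite: Gelbart1975, Thm. 5.7 and Thm. 10.10 (proof), p. 158; Corvallis1979] -/
theorem CuspidalAutomorphicRepGL.eq_of_sliceEquiv
    (hSMO : strong_multiplicity_one_gl_of_hasLocalComponentAt (n := n) (K := K) (μ := μ))
    (S : Finset (HeightOneSpectrum (𝓞 K)))
    (E : ((AdelicGroupData.gl n K).L2 μ) →L[ℂ] ((AdelicGroupData.gl n K).L2 μ)) (hEidem : ∀ y, E (E y) = E y)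
    (hET : ∀ T : ((AdelicGroupData.gl n K).L2 μ) →L[ℂ] ((AdelicGroupData.gl n K).L2 μ), (∀ γ, T ∘L ((AdelicGroupData.gl n K).rightRegular μ) γ = ((AdelicGroupData.gl n K).rightRegular μ) γ ∘L T) → T ∘L E = E ∘L T)
    (hEv : ∀ v ∉ S, ∀ g : GL (Fin n) (v.adicCompletion K),
      E ∘L ((AdelicGroupData.gl n K).rightRegular μ) (GLn.toAdelic n K v g) = ((AdelicGroupData.gl n K).rightRegular μ) (GLn.toAdelic n K v g) ∘L E)
    (P P' : CuspidalAutomorphicRepGL n K μ)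
    (σ σ' : Submodule ℂ ((AdelicGroupData.gl n K).L2 μ)) (hσ : ∀ x, x ∈ σ ↔ x ∈ P.1 ∧ E x = x)
    (hσ' : ∀ x, x ∈ σ' ↔ x ∈ P'.1 ∧ E x = x) (hσ0 : σ ≠ ⊥)
    (U : σ →ₗ[ℂ] σ') (hUinj : Function.Injective U) (hUsurj : Function.Surjective U)
    (hU : ∀ v ∉ S, ∀ (g : GL (Fin n) (v.adicCompletion K)) (x : σ)
      (hx : ((AdelicGroupData.gl n K).rightRegular μ) (GLn.toAdelic n K v g) (x : ((AdelicGroupData.gl n K).L2 μ)) ∈ σ),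
      (U ⟨((AdelicGroupData.gl n K).rightRegular μ) (GLn.toAdelic n K v g) x, hx⟩ : ((AdelicGroupData.gl n K).L2 μ)) = ((AdelicGroupData.gl n K).rightRegular μ) (GLn.toAdelic n K v g) (U x)) :
    P = P' := by
  -- `σ' ≠ 0` and the inverse bijection
  have hσ'0 : σ' ≠ ⊥ := by
    obtain ⟨y₀, hy₀, hy₀0⟩ := (Submodule.ne_bot_iff σ).1 hσ0
    refine (Submodule.ne_bot_iff σ').2 ⟨U ⟨y₀, hy₀⟩, (U ⟨y₀, hy₀⟩).2, fun h0 => hy₀0 ?_⟩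
    have h1 : U ⟨y₀, hy₀⟩ = 0 := Subtype.ext h0
    have h2 : (⟨y₀, hy₀⟩ : σ) = 0 := hUinj (by rw [h1, map_zero])
    exact congrArg Subtype.val h2
  let Ue : σ ≃ₗ[ℂ] σ' := LinearEquiv.ofBijective U ⟨hUinj, hUsurj⟩
  have hUe : ∀ x, Ue x = U x := fun x => rfl
  have hU' : ∀ v ∉ S, ∀ (g : GL (Fin n) (v.adicCompletion K)) (y : σ')
      (hy : ((AdelicGroupData.gl n K).rightRegular μ) (GLn.toAdelic n K v g) (y : ((AdelicGroupData.gl n K).L2 μ)) ∈ σ'),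
      ((Ue.symm : σ' →ₗ[ℂ] σ) ⟨((AdelicGroupData.gl n K).rightRegular μ) (GLn.toAdelic n K v g) y, hy⟩ : ((AdelicGroupData.gl n K).L2 μ)) =
        ((AdelicGroupData.gl n K).rightRegular μ) (GLn.toAdelic n K v g) ((Ue.symm : σ' →ₗ[ℂ] σ) y) := by
    intro v hv g y hy
    set x : σ := Ue.symm y with hxdef
    have hyx : U x = y := by rw [← hUe, hxdef, LinearEquiv.apply_symm_apply]
    have hx : ((AdelicGroupData.gl n K).rightRegular μ) (GLn.toAdelic n K v g) (x : ((AdelicGroupData.gl n K).L2 μ)) ∈ σ := by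
      obtain ⟨hW₁, hE₁⟩ := (hσ _).1 x.2
      refine (hσ _).2 ⟨P.1.apply_mem _ hW₁, ?_⟩
      have h := DFunLike.congr_fun (hEv v hv g) (x : ((AdelicGroupData.gl n K).L2 μ))
      simp only [ContinuousLinearMap.coe_comp, Function.comp_apply] at h
      rw [h, hE₁]
    have h1 : (⟨((AdelicGroupData.gl n K).rightRegular μ) (GLn.toAdelic n K v g) (y : ((AdelicGroupData.gl n K).L2 μ)), hy⟩ : σ') =
        U ⟨((AdelicGroupData.gl n K).rightRegular μ) (GLn.toAdelic n K v g) (x : ((AdelicGroupData.gl n K).L2 μ)), hx⟩ := by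
      apply Subtype.ext
      change ((AdelicGroupData.gl n K).rightRegular μ) (GLn.toAdelic n K v g) (y : ((AdelicGroupData.gl n K).L2 μ)) = (U ⟨((AdelicGroupData.gl n K).rightRegular μ) (GLn.toAdelic n K v g) (x : ((AdelicGroupData.gl n K).L2 μ)), hx⟩ : ((AdelicGroupData.gl n K).L2 μ))
      rw [hU v hv g x hx, hyx]
    change ((Ue.symm ⟨((AdelicGroupData.gl n K).rightRegular μ) (GLn.toAdelic n K v g) (y : ((AdelicGroupData.gl n K).L2 μ)), hy⟩ : σ) : ((AdelicGroupData.gl n K).L2 μ)) = _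
    rw [h1, ← hUe, LinearEquiv.symm_apply_apply]
    rfl
  refine hSMO P P' S fun v hv V _ _ ρ _ _ => ⟨fun h => ?_, fun h => ?_⟩
  · exact hasLocalComponentAt_of_sliceIntertwiner v E hEidem hET (hEv v hv) P.1 P'.1
      P.isTopIrreducible σ σ' hσ hσ' hσ0 U hUinj (hU v hv) ρ h
  · exact hasLocalComponentAt_of_sliceIntertwiner v E hEidem hET (hEv v hv) P'.1 P.1
      P'.isTopIrreducible σ' σ hσ' hσ hσ'0 (Ue.symm : σ' →ₗ[ℂ] σ) Ue.symm.injective (hU' v hv)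
      ρ h

/-- `ι_v(g) ∈ G^S` for `v ∉ S`: the local embedding at a place outside `S` lands in the subgroup
of elements trivial at the places of `S`. [folklore] -/
theorem GLn.toAdelic_mem_trivialAt_of_not_mem {S : Finset (HeightOneSpectrum (𝓞 K))}
    {v : HeightOneSpectrum (𝓞 K)} (hv : v ∉ S) (g : GL (Fin n) (v.adicCompletion K)) :
    GLn.toAdelic n K v g ∈ GLn.trivialAt n K S := by
  rw [GLn.mem_trivialAt_iff]
  intro w hw
  have hne : v ≠ w := fun h => hv (h ▸ hw)
  exact GLn.toLocalAt_toAdelic_of_ne hne g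

/-- **Cuspidal constituents with `G^S`-equivalent slices coincide, given strong multiplicity
one** — the hypothesis `hsep` of `ContRepresentation.submodule_eq_of_sliceDecomposition` for the
regular representation of `GL_n(𝔸_K)` on `L²`, the complementary group
`G^S = GLn.trivialAt n K S ↪ GL_n(𝔸_K)` and the cuspidal constituents `P, P'`: `E` an idempotent
commuting with the commutant and with `R(G^S)`, slices `σ, σ'` with `σ ≠ 0`, and an isometric map
of `σ` onto `σ'` commuting with `R(G^S)`; then `P = P'`.
[cite: Gelbart1975, Thm. 5.7 and Thm. 10.10 (proof), p. 158; Corvallis1979] -/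
theorem CuspidalAutomorphicRepGL.eq_of_sliceEquiv_trivialAt
    (hSMO : strong_multiplicity_one_gl_of_hasLocalComponentAt (n := n) (K := K) (μ := μ))
    (S : Finset (HeightOneSpectrum (𝓞 K)))
    (E : ((AdelicGroupData.gl n K).L2 μ) →L[ℂ] ((AdelicGroupData.gl n K).L2 μ)) (hEidem : ∀ y, E (E y) = E y)
    (hET : ∀ T : ((AdelicGroupData.gl n K).L2 μ) →L[ℂ] ((AdelicGroupData.gl n K).L2 μ), (∀ γ, T ∘L ((AdelicGroupData.gl n K).rightRegular μ) γ = ((AdelicGroupData.gl n K).rightRegular μ) γ ∘L T) → T ∘L E = E ∘L T)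
    (hEG : ∀ g : GLn.trivialAt n K S,
      E ∘L ((AdelicGroupData.gl n K).rightRegular μ) (g : (AdelicGroupData.gl n K).Adelic) = ((AdelicGroupData.gl n K).rightRegular μ) (g : (AdelicGroupData.gl n K).Adelic) ∘L E)
    (P P' : CuspidalAutomorphicRepGL n K μ)
    (σ σ' : Submodule ℂ ((AdelicGroupData.gl n K).L2 μ)) (hσ : ∀ x, x ∈ σ ↔ x ∈ P.1 ∧ E x = x)
    (hσ' : ∀ x, x ∈ σ' ↔ x ∈ P'.1 ∧ E x = x) (hσ0 : σ ≠ ⊥)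
    (hσG : ∀ g : GLn.trivialAt n K S, ∀ x ∈ σ, ((AdelicGroupData.gl n K).rightRegular μ) (g : (AdelicGroupData.gl n K).Adelic) x ∈ σ)
    (hequiv : ∃ U : σ →L[ℂ] σ', (∀ x, ‖U x‖ = ‖x‖) ∧ Function.Surjective U ∧
      ∀ (g : GLn.trivialAt n K S) (x : σ),
        (U ⟨((AdelicGroupData.gl n K).rightRegular μ) (g : (AdelicGroupData.gl n K).Adelic) x, hσG g x x.2⟩ : ((AdelicGroupData.gl n K).L2 μ)) =
          ((AdelicGroupData.gl n K).rightRegular μ) (g : (AdelicGroupData.gl n K).Adelic) (U x)) :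
    P = P' := by
  obtain ⟨U, hUn, hUs, hUG⟩ := hequiv
  have hUinj : Function.Injective U := by
    intro x y hxy
    have h : ‖U (x - y)‖ = 0 := by rw [map_sub, hxy, sub_self, norm_zero]
    rw [hUn, norm_eq_zero] at h
    exact sub_eq_zero.1 h
  refine CuspidalAutomorphicRepGL.eq_of_sliceEquiv hSMO S E hEidem hET
    (fun v hv g => hEG ⟨_, GLn.toAdelic_mem_trivialAt_of_not_mem hv g⟩) P P' σ σ' hσ hσ' hσ0
    (U : σ →ₗ[ℂ] σ') hUinj hUs fun v hv g x hx => ?_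
  exact hUG ⟨_, GLn.toAdelic_mem_trivialAt_of_not_mem hv g⟩ x

end SliceLocalComponent

end Literature.NumberTheory.Automorphic
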